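import Literature.NumberTheory.EllipticCurves.BSDRankZeroFamily
import Literature.NumberTheory.EllipticCurves.ShortWeierstrassGoodTwistLocalProofs
import HarnessLib

/-!
# Bhargava–Shankar, Theorem 4: the root-number family from the Modularity Theorem

Third file on the named fact `Literature.NumberTheory.EllipticCurves.pos_proportion_rank_zero`
(Bhargava–Shankar, *Ternary cubic forms having bounded invariants, and the existence of a positive
proportion of elliptic curves having rank 0*, Ann. of Math. 181 (2015), Thm 4; arXiv:1007.0052v2).
`BSDRankZeroDensity` proved Thm 4 from three inputs, the second being the existence of a positive
proportion union of large congruence families, stable under `E ↦ E₋₁ = E_{A,−B}`, on which the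
twist by `−1` **reverses the root number** (`exists_isLarge_rootNumber_twist_family`; the source's
§4.1 family does this with curves additive at `2`, invoking S. Wong's local root numbers at `2`,
which the tree cannot express — `BSDRankZeroFamily` had to vendor that sentence as the named fact
`rootNumber_negB_of_isBSFamily`).

This file and its sibling `BSDRankZeroGoodTwistFamilyProofs` **prove**
`exists_isLarge_rootNumber_twist_family` from the Modularity Theorem `exists_isNewformOf` alone
(`exists_isLarge_rootNumber_twist_family_of_exists_isNewformOf`, sibling file), with a different
explicit family: the `2`-adic class of `E_{−16,16} ≅ 37a1`,

`G = { E_{A,B} : A ≡ −16, B ≡ 16 (mod 64), 4A³ + 27B² squarefree away from 2, 4A³ + 27B² < 0 }`,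

and its twist `G₋₁ = { E_{A,−B} : E_{A,B} ∈ G }` (`B ≡ −16 (mod 64)`). For `E = E_{A,B} ∈ G`
(`ShortWeierstrassGoodTwistLocalProofs`): `E` has good reduction at `2`, odd squarefree conductor
`N ≡ 1 (mod 4)`, and `E₋₁ = E^{(−1)}` is additive at `2`; hence `aₙ(E₋₁) = χ₋₄(n) aₙ(E)` and, by
Atkin–Lehner–Li twisting of the newform of `E` by the primitive character `χ₋₄` of conductor `4`
prime to `N` (Murty–Murty 1997, Ch. 6 §1: sign `ω χ_D(−N)` with `D = −4`),
**`w(E₋₁) = χ₋₄(−N) w(E) = −w(E)`** (sibling file, `rootNumber_negB_of_isGTFamily`;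
`QuadraticTwistNegOneRootNumberProofs`, `TwistRootNumberModularityProofs`). This file contains the
definitions of the two pieces as congruence families and the sieve-theoretic part: largeness of `G`,
`G₋₁` at every odd prime and positive proportion, by the squarefree sieve of `BSDRankZeroSieve`
(`RankZeroSieve.main_count`), exactly as for `BSDRankZeroFamily`.

## Main results

* `IsGTFamily t`, `gtFamily t`, `gtFamilies` : the two pieces `G` (`t = true`), `G₋₁` (`t = false`)
  as congruence families (`CongruenceFamily` of `BSDRankZeroDensity`); `mem_gtFamily_iff`,
  `gtFamilies_disjoint`, `isGTFamily_negB_iff` (the twist swaps the pieces), `IsGTFamily.exists_eq`,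
  `isGTFamily_base`, `isGTFamily_base_neg` (non-vacuity: `(−16, ±16)` are members).
* `isLarge_gtFamily`, `exists_pos_le_heightProportion_isGTFamily`,
  `exists_pos_le_heightProportion_unionMem_gtFamilies` : large, positive proportion.

## References

* [BhargavaShankarTernary2015] M. Bhargava, A. Shankar, Ann. of Math. 181 (2015), 587–621
  (arXiv:1007.0052v2), Thm 4, Thm 27, Thm 41–42 and §4.1.
* [MurtyMurty1997] M. R. Murty, V. K. Murty, *Non-vanishing of `L`-functions and applications*
  (1997), Ch. 6, §1.
-/

noncomputable section

open scoped Classical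
open Filter Finset WeierstrassCurve
open Literature.NumberTheory.EllipticCurves.RankZeroSieve

namespace Literature.NumberTheory.EllipticCurves

/-! ### The family in coordinates -/

section Family

/-- The residue of `B` modulo `64`: `16` on the base piece `G` (`t = true`), `−16` on its twist
`G₋₁` (`t = false`). [folklore] -/
def gtRes (t : Bool) : ℤ := if t then 16 else -16

/-- **The pieces `G` (`t = true`) and `G₋₁` (`t = false`)** as predicates on `(A, B)`:
`A ≡ −16 (mod 64)`, `B ≡ ±16 (mod 64)`, `4A³ + 27B²` squarefree away from `2` and negative
(positive discriminant). `G` is the `2`-adic class of `E_{−16,16} ≅ 37a1`, a curve of good reduction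
at `2` and conductor `37 ≡ 1 (mod 4)`. [folklore] -/
def IsGTFamily (t : Bool) (AB : ℤ × ℤ) : Prop :=
  AB.1 ≡ -16 [ZMOD 64] ∧ AB.2 ≡ gtRes t [ZMOD 64] ∧ OddSqfree AB ∧ negDisc AB < 0

/-- The exponent `k_p` of the local condition: residues modulo `2⁶` at `p = 2` and modulo `p²` at
odd `p`. [cite: BhargavaShankarTernary2015, §3 (arXiv v2 p. 14), families defined by congruence conditions] -/
def gtExpt (p : ℕ) : ℕ := if p = 2 then 6 else 2

/-- The local condition at `p`, on integer representatives: the class modulo `64` at `2`,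
`p² ∤ 4A³ + 27B²` at odd `p`. [cite: BhargavaShankarTernary2015, §3 (arXiv v2 p. 14)] -/
def GTLocalCond (t : Bool) (p : ℕ) (AB : ℤ × ℤ) : Prop :=
  if p = 2 then AB.1 ≡ -16 [ZMOD 64] ∧ AB.2 ≡ gtRes t [ZMOD 64] else ¬ (p : ℤ) ^ 2 ∣ negDisc AB

/-- **The pieces as families defined by congruence conditions** (`CongruenceFamily` of
`BSDRankZeroDensity`; source §3, p. 14): at each prime the allowed residues modulo `p ^ gtExpt p` are
those of the integer pairs satisfying `GTLocalCond t p`; at infinity only positive discriminant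
(`4A³ + 27B² < 0`) is allowed. Membership is `IsGTFamily t` (`mem_gtFamily_iff`).
[cite: BhargavaShankarTernary2015, §3 (arXiv v2 p. 14), families defined by congruence conditions] -/
def gtFamily (t : Bool) : CongruenceFamily where
  expt := gtExpt
  residues p := {xy | ∃ AB : ℤ × ℤ, GTLocalCond t p AB ∧
    xy = ((AB.1 : ZMod (p ^ gtExpt p)), (AB.2 : ZMod (p ^ gtExpt p)))}
  allowPos := True
  allowNeg := False

/-- The two pieces `G`, `G₋₁`, indexed by `Fin 2` as required by `UnionMem`. [folklore] -/
def gtFamilies : Fin 2 → CongruenceFamily := ![gtFamily true, gtFamily false]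

/-- The local condition depends only on residues modulo `p ^ gtExpt p`. [folklore] -/
theorem gtLocalCond_of_modEq {t : Bool} {p : ℕ} {AB AB' : ℤ × ℤ} (h : GTLocalCond t p AB')
    (h1 : AB.1 ≡ AB'.1 [ZMOD (p : ℤ) ^ gtExpt p]) (h2 : AB.2 ≡ AB'.2 [ZMOD (p : ℤ) ^ gtExpt p]) :
    GTLocalCond t p AB := by
  unfold GTLocalCond at h ⊢
  by_cases hp : p = 2
  · subst hp
    rw [if_pos rfl] at h ⊢
    have e : ((2 : ℕ) : ℤ) ^ gtExpt 2 = 64 := by simp [gtExpt]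
    rw [e] at h1 h2
    exact ⟨h1.trans h.1, h2.trans h.2⟩
  · rw [if_neg hp] at h ⊢
    have e : gtExpt p = 2 := if_neg hp
    rw [e] at h1 h2
    have hD : negDisc AB ≡ negDisc AB' [ZMOD (p : ℤ) ^ 2] := negDisc_modEq h1 h2
    exact fun hdvd ↦ h (hD.dvd_iff.mp hdvd)

/-- Members are in the height family: `4A³ + 27B² ≠ 0`, `2⁶ ∤ B` (as `B ≡ ±16 (mod 64)`), and for
odd `p`, `p⁴ ∣ A`, `p⁶ ∣ B` would give `p² ∣ 4A³ + 27B²`. [folklore] -/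
theorem IsGTFamily.isInHeightFamily {t : Bool} {AB : ℤ × ℤ} (h : IsGTFamily t AB) :
    IsInHeightFamily AB := by
  obtain ⟨_, hB, hsq, hneg⟩ := h
  refine ⟨hneg.ne, fun p hp ⟨h4, h6⟩ ↦ ?_⟩
  by_cases hp2 : p = 2
  · subst hp2
    have h64 : (64 : ℤ) ∣ AB.2 := by simpa using h6
    have h0 : AB.2 % 64 = 0 := Int.emod_eq_zero_of_dvd h64
    have hB' : AB.2 % 64 = gtRes t % 64 := hB
    cases t <;> simp [gtRes] at hB' <;> omega
  · obtain ⟨a, ha⟩ := h4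
    obtain ⟨b, hb⟩ := h6
    refine hsq p hp hp2 ⟨4 * (p : ℤ) ^ 10 * a ^ 3 + 27 * (p : ℤ) ^ 10 * b ^ 2, ?_⟩
    change 4 * AB.1 ^ 3 + 27 * AB.2 ^ 2 = _
    rw [ha, hb]; ring

/-- **`gtFamily t` has membership predicate `IsGTFamily t`.** [folklore] -/
theorem mem_gtFamily_iff (t : Bool) (AB : ℤ × ℤ) : (gtFamily t).Mem AB ↔ IsGTFamily t AB := by
  constructor
  · rintro ⟨hfam, hloc, _, hneg⟩
    have hcond : ∀ p : ℕ, p.Prime → GTLocalCond t p AB := by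
      intro p hp
      obtain ⟨AB', hc, heq⟩ := hloc p hp
      obtain ⟨e1, e2⟩ := Prod.mk.inj heq
      have e1' : AB.1 ≡ AB'.1 [ZMOD ((p ^ gtExpt p : ℕ) : ℤ)] :=
        (ZMod.intCast_eq_intCast_iff _ _ _).mp e1
      have e2' : AB.2 ≡ AB'.2 [ZMOD ((p ^ gtExpt p : ℕ) : ℤ)] :=
        (ZMod.intCast_eq_intCast_iff _ _ _).mp e2
      push_cast at e1' e2'
      exact gtLocalCond_of_modEq hc e1' e2'
    have h2 := hcond 2 Nat.prime_two
    simp only [GTLocalCond, ↓reduceIte] at h2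
    refine ⟨h2.1, h2.2, fun p hp hp2 ↦ ?_, ?_⟩
    · have := hcond p hp
      simp only [GTLocalCond, hp2, ↓reduceIte] at this
      exact this
    · have hD : negDisc AB ≠ 0 := hfam.1
      change (-negDisc AB < 0 → False) at hneg
      rcases lt_trichotomy (negDisc AB) 0 with h | h | h
      · exact h
      · exact (hD h).elim
      · exact (hneg (by linarith)).elim
  · intro h
    have hfam := h.isInHeightFamily
    obtain ⟨hA, hB, hsq, hsign⟩ := h
    refine ⟨hfam, fun p hp ↦ ⟨AB, ?_, rfl⟩, fun _ ↦ trivial, ?_⟩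
    · unfold GTLocalCond
      by_cases hp2 : p = 2
      · rw [if_pos hp2]; exact ⟨hA, hB⟩
      · rw [if_neg hp2]; exact hsq p hp hp2
    · change (-negDisc AB < 0 → False)
      intro h0
      linarith

/-- Membership in the union of the two pieces. [folklore] -/
theorem unionMem_gtFamilies_iff (AB : ℤ × ℤ) :
    UnionMem gtFamilies AB ↔ IsGTFamily true AB ∨ IsGTFamily false AB := by
  simp only [UnionMem, Fin.exists_fin_two, gtFamilies, Matrix.cons_val_zero, Matrix.cons_val_one,
    mem_gtFamily_iff]

/-- The two pieces are disjoint (`B ≡ 16` versus `B ≡ −16 (mod 64)`). [folklore] -/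
theorem gtFamilies_disjoint (i j : Fin 2) (hij : i ≠ j) (AB : ℤ × ℤ) (hi : (gtFamilies i).Mem AB) :
    ¬ (gtFamilies j).Mem AB := by
  intro hj
  have key : ∀ AB : ℤ × ℤ, IsGTFamily true AB → IsGTFamily false AB → False := by
    intro AB h₁ h₂
    have a : AB.2 % 64 = 16 % 64 := h₁.2.1
    have b : AB.2 % 64 = (-16) % 64 := h₂.2.1
    omega
  fin_cases i <;> fin_cases j
  · exact hij rfl
  · simp only [gtFamilies, Fin.zero_eta, Fin.mk_one, Matrix.cons_val_zero, Matrix.cons_val_one,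
      mem_gtFamily_iff] at hi hj
    exact key AB hi hj
  · simp only [gtFamilies, Fin.zero_eta, Fin.mk_one, Matrix.cons_val_zero, Matrix.cons_val_one,
      mem_gtFamily_iff] at hi hj
    exact key AB hj hi
  · exact hij rfl

/-- **The twist by `−1` swaps the two pieces**: `IsGTFamily t (A, −B) ↔ IsGTFamily (!t) (A, B)`.
[cite: BhargavaShankarTernary2015, §4.1 (arXiv v2), "the twist E₋₁ of E by −1 is also clearly in F"] -/
theorem isGTFamily_negB_iff (t : Bool) (AB : ℤ × ℤ) : IsGTFamily t (negB AB) ↔ IsGTFamily (!t) AB := by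
  simp only [IsGTFamily, negDisc_negB, oddSqfree_negB_iff]
  have h : (negB AB).2 ≡ gtRes t [ZMOD 64] ↔ AB.2 ≡ gtRes (!t) [ZMOD 64] := by
    change -AB.2 ≡ gtRes t [ZMOD 64] ↔ AB.2 ≡ gtRes (!t) [ZMOD 64]
    cases t <;> simp only [gtRes, Bool.not_true, Bool.not_false, ↓reduceIte, Bool.false_eq_true] <;>
      constructor <;> intro h' <;> have := h'.neg <;> simpa using this
  rw [h]
  rfl

/-- The union `G ∪ G₋₁` is stable under `E ↦ E₋₁`. [folklore] -/
theorem unionMem_gtFamilies_negB {AB : ℤ × ℤ} (h : UnionMem gtFamilies AB) :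
    UnionMem gtFamilies (AB.1, -AB.2) := by
  rw [unionMem_gtFamilies_iff] at h ⊢
  change IsGTFamily true (negB AB) ∨ IsGTFamily false (negB AB)
  rw [isGTFamily_negB_iff, isGTFamily_negB_iff]
  tauto

/-- A member of the piece `t` in the coordinates `A = 64k − 16`, `B = ±(64m + 16)`. [folklore] -/
theorem IsGTFamily.exists_eq {t : Bool} {AB : ℤ × ℤ} (h : IsGTFamily t AB) :
    ∃ k m : ℤ, AB.1 = 64 * k - 16 ∧ AB.2 = (if t then 64 * m + 16 else -(64 * m + 16)) := by
  obtain ⟨hA, hB, -, -⟩ := h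
  obtain ⟨k, hk⟩ := (Int.modEq_iff_dvd.mp hA.symm)
  cases t
  · obtain ⟨m, hm⟩ := (Int.modEq_iff_dvd.mp hB.symm)
    refine ⟨k, -m, by linarith, ?_⟩
    simp only [gtRes, Bool.false_eq_true, ↓reduceIte] at hm ⊢
    linarith
  · obtain ⟨m, hm⟩ := (Int.modEq_iff_dvd.mp hB.symm)
    refine ⟨k, m, by linarith, ?_⟩
    simp only [gtRes, ↓reduceIte] at hm ⊢
    linarith

/-- `4A³ + 27B²` is squarefree away from `2` as soon as `|4A³ + 27B²| = 2⁸ q` with `q` an odd prime.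
[folklore] -/
theorem oddSqfree_of_natAbs_negDisc_eq_prime {AB : ℤ × ℤ} {q : ℕ} (hq : q.Prime) (hq2 : q ≠ 2)
    (h : (negDisc AB).natAbs = 2 ^ 8 * q) : OddSqfree AB := by
  intro p hp hp2 hdvd
  have h1 : p ^ 2 ∣ 2 ^ 8 * q := by
    rw [← h, ← Int.natCast_dvd_natCast, Int.dvd_natAbs]; exact_mod_cast hdvd
  have hp2' : Nat.Coprime (p ^ 2) (2 ^ 8) :=
    Nat.Coprime.pow 2 8 ((Nat.coprime_primes hp Nat.prime_two).mpr hp2)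
  have h2 : p ^ 2 ∣ q := hp2'.dvd_of_dvd_mul_left h1
  have hpq : p ∣ q := (dvd_pow_self p two_ne_zero).trans h2
  have hpq' : p = q := (Nat.prime_dvd_prime_iff_eq hp hq).mp hpq
  subst hpq'
  have : p ^ 2 ≤ p := Nat.le_of_dvd hp.pos h2
  nlinarith [hp.two_le]

/-- **Non-vacuity: `E_{−16,16} ≅ 37a1` is in the base piece `G`** (`4A³ + 27B² = −2⁸ · 37`).
[folklore] -/
theorem isGTFamily_base : IsGTFamily true (-16, 16) := by
  refine ⟨Int.ModEq.refl _, Int.ModEq.refl _, ?_, by rw [negDisc_apply]; norm_num⟩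
  refine oddSqfree_of_natAbs_negDisc_eq_prime (q := 37) (by norm_num) (by norm_num) ?_
  rw [negDisc_apply]; norm_num

/-- **Non-vacuity: `E_{−16,−16}` (the twist of `37a1` by `−1`, conductor `592`) is in `G₋₁`.**
[folklore] -/
theorem isGTFamily_base_neg : IsGTFamily false (-16, -16) := by
  refine ⟨Int.ModEq.refl _, Int.ModEq.refl _, ?_, by rw [negDisc_apply]; norm_num⟩
  refine oddSqfree_of_natAbs_negDisc_eq_prime (q := 37) (by norm_num) (by norm_num) ?_
  rw [negDisc_apply]; norm_num

end Family

/-! ### "The set `G` is a large family" -/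

section Large

/-- Base points of the two `2`-adic classes: `(−16, 16)` (`E_{−16,16} ≅ 37a1`, `4A³ + 27B² = −2⁸·37`)
and `(−16, −16)` (its twist by `−1`). [folklore] -/
theorem exists_gtBase (t : Bool) :
    ∃ a₂ b₂ : ℤ, a₂ ≡ -16 [ZMOD 64] ∧ b₂ ≡ gtRes t [ZMOD 64] ∧ ¬ (2 : ℤ) ^ 2 ∣ negDisc (a₂, b₂) / 256 := by
  cases t
  · exact ⟨-16, -16, Int.ModEq.refl _, Int.ModEq.refl _, by rw [negDisc_apply]; decide⟩
  · exact ⟨-16, 16, Int.ModEq.refl _, Int.ModEq.refl _, by rw [negDisc_apply]; decide⟩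

/-- `2⁶` and a power of an odd prime are coprime. [folklore] -/
theorem isCoprime_sixtyfour_prime_pow {p : ℕ} (hp : p.Prime) (hp2 : p ≠ 2) (k : ℕ) :
    IsCoprime ((64 : ℤ)) ((p : ℤ) ^ k) := by
  have h : Nat.Coprime (2 ^ 6) (p ^ k) :=
    Nat.Coprime.pow 6 k ((Nat.coprime_primes Nat.prime_two hp).mpr (Ne.symm hp2))
  exact_mod_cast h.isCoprime

/-- **"The set `G` is a large family"** (source §4.1, for our family), for each piece: for every odd
prime `p`, every class `(a, b)` modulo `p ^ k` with `p² ∤ 4a³ + 27b²` contains a member (Chinese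
remainder theorem with the `2`-adic class, then the sieve count `RankZeroSieve.main_count`, which
produces pairs with `4A³ + 27B²` squarefree away from `2` and negative).
[cite: BhargavaShankarTernary2015, §3 (arXiv v2 p. 14), definition of a large family, and §4.1] -/
theorem isLarge_gtFamily (t : Bool) : (gtFamily t).IsLarge := by
  refine ⟨3, fun p hp3 hp a b k hD ↦ ?_⟩
  have hp2 : p ≠ 2 := by omega
  obtain ⟨a₂, b₂, ha₂, hb₂, -⟩ := exists_gtBase t
  set k' : ℕ := max k 2 with hk'
  have hcop := isCoprime_sixtyfour_prime_pow hp hp2 k'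
  obtain ⟨a₀, ha₀2, ha₀p⟩ := exists_modEq_and_modEq hcop a₂ a
  obtain ⟨b₀, hb₀2, hb₀p⟩ := exists_modEq_and_modEq hcop b₂ b
  set N : ℕ := 64 * p ^ k' with hNdef
  have hN : 0 < N := by positivity
  have hNcast : (N : ℤ) = 64 * (p : ℤ) ^ k' := by simp [hNdef]
  have hpk : (p : ℤ) ^ 2 ∣ (p : ℤ) ^ k' := pow_dvd_pow _ (le_max_right k 2)
  have hDab : negDisc (a₀, b₀) ≡ negDisc (a, b) [ZMOD (p : ℤ) ^ 2] :=
    negDisc_modEq (ha₀p.of_dvd hpk) (hb₀p.of_dvd hpk)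
  have hcompat : ∀ q : ℕ, q.Prime → q ≠ 2 → (q : ℤ) ∣ N →
      (q : ℤ) ^ 2 ∣ N ∧ ¬ (q : ℤ) ^ 2 ∣ negDisc (a₀, b₀) := by
    intro q hq hq2 hqN
    have hqN' : q ∣ 2 ^ 6 * p ^ k' := by
      rw [hNdef] at hqN; exact_mod_cast hqN
    rcases (Nat.Prime.dvd_mul hq).mp hqN' with h | h
    · exact absurd ((Nat.prime_dvd_prime_iff_eq hq Nat.prime_two).mp (hq.dvd_of_dvd_pow h)) hq2
    · have hqp : q = p := (Nat.prime_dvd_prime_iff_eq hq hp).mp (hq.dvd_of_dvd_pow h)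
      subst hqp
      refine ⟨?_, fun hdvd ↦ hD ?_⟩
      · rw [hNcast]; exact dvd_mul_of_dvd_right hpk _
      · rw [← negDisc_apply]; exact hDab.dvd_iff.mp hdvd
  obtain ⟨X, AB, hbox, ⟨hA, hB⟩, hsq⟩ := exists_mem_box_class_oddSqfree false hN a₀ b₀ hcompat
  rw [hNcast] at hA hB
  have hA2 : AB.1 ≡ a₀ [ZMOD 64] := hA.of_dvd (dvd_mul_right _ _)
  have hB2 : AB.2 ≡ b₀ [ZMOD 64] := hB.of_dvd (dvd_mul_right _ _)
  have hAp : AB.1 ≡ a₀ [ZMOD (p : ℤ) ^ k'] := hA.of_dvd (dvd_mul_left _ _)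
  have hBp : AB.2 ≡ b₀ [ZMOD (p : ℤ) ^ k'] := hB.of_dvd (dvd_mul_left _ _)
  have hkk : (p : ℤ) ^ k ∣ (p : ℤ) ^ k' := pow_dvd_pow _ (le_max_left k 2)
  refine ⟨AB, ?_, (hAp.trans ha₀p).of_dvd hkk, (hBp.trans hb₀p).of_dvd hkk⟩
  rw [mem_gtFamily_iff]
  exact ⟨(hA2.trans ha₀2).trans ha₂, (hB2.trans hb₀2).trans hb₂, hsq, negDisc_neg_of_mem_box hbox⟩

end Large

/-! ### Positive proportion -/

section Density

/-- **The base piece `G` has positive proportion**: eventually in `X`, its members form a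
proportion `≥ c > 0` of all curves of naive height `< X` (the sieve count
`RankZeroSieve.main_count` for the class of `(−16, 16)` modulo `64`, against the count of all curves,
`card_heightFamilyBelow_asymptotic_holds`; Bhargava–Shankar, Ann. of Math. 181 (2015) 191–242,
Lemma 5.15 for the latter). [cite: BhargavaShankarTernary2015, §4.1 (arXiv v2), "an explicit positive proportion large family"] -/
theorem exists_pos_le_heightProportion_isGTFamily :
    ∃ c : ℝ, 0 < c ∧ ∀ᶠ X : ℕ in atTop, c ≤ heightProportion (IsGTFamily true) X := by
  have hcompat : ∀ p : ℕ, p.Prime → p ≠ 2 → (p : ℤ) ∣ ((64 : ℕ) : ℤ) →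
      (p : ℤ) ^ 2 ∣ ((64 : ℕ) : ℤ) ∧ ¬ (p : ℤ) ^ 2 ∣ negDisc (-16, 16) := by
    intro p hp hp2 hdvd
    have h' : p ∣ 2 ^ 6 := by exact_mod_cast hdvd
    exact absurd ((Nat.prime_dvd_prime_iff_eq hp Nat.prime_two).mp (hp.dvd_of_dvd_pow h')) hp2
  obtain ⟨c₁, hc₁, hev⟩ := main_count false (N := 64) (by norm_num) (-16) 16 hcompat
  set K : ℝ := |heightFamilyConstant| + 1 with hK
  have hK0 : 0 < K := by positivity
  have hall : ∀ᶠ X : ℕ in atTop,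
      ((heightFamilyBelow X).card : ℝ) / (X : ℝ) ^ (5 / 6 : ℝ) ≤ K :=
    card_heightFamilyBelow_asymptotic_holds.eventually_le_const
      (lt_of_le_of_lt (le_abs_self _) (lt_add_one _))
  refine ⟨c₁ / K, by positivity, ?_⟩
  filter_upwards [hev, hall, eventually_ge_atTop 1] with X hX1 hX2 hX3
  have hX0 : (0 : ℝ) < X := by exact_mod_cast hX3
  have hX56 : (0 : ℝ) < (X : ℝ) ^ (5 / 6 : ℝ) := Real.rpow_pos_of_pos hX0 _
  rw [aX_mul_bX X hX3] at hX1
  rw [div_le_iff₀ hX56] at hX2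
  have hsub : (Ibox false X ×ˢ Jbox X).filter (fun AB : ℤ × ℤ ↦
      (AB.1 ≡ -16 [ZMOD ((64 : ℕ) : ℤ)] ∧ AB.2 ≡ 16 [ZMOD ((64 : ℕ) : ℤ)]) ∧ OddSqfree AB) ⊆
      (heightFamilyBelow X).filter (IsGTFamily true) := by
    intro AB hAB
    rw [Finset.mem_filter] at hAB ⊢
    obtain ⟨hbox, ⟨hA, hB⟩, hsq⟩ := hAB
    push_cast at hA hB
    have hmem : IsGTFamily true AB := ⟨hA, hB, hsq, negDisc_neg_of_mem_box hbox⟩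
    refine ⟨?_, hmem⟩
    rw [mem_heightFamilyBelow_iff]
    refine ⟨hmem.isInHeightFamily, ?_⟩
    obtain ⟨h4, h27⟩ := height_lt_of_mem_box hX3 hbox
    exact max_lt h4 h27
  have hcard := Finset.card_le_card hsub
  have hfilt : c₁ * (X : ℝ) ^ (5 / 6 : ℝ) ≤ ((heightFamilyBelow X).filter (IsGTFamily true)).card :=
    hX1.trans (by exact_mod_cast hcard)
  rw [heightProportion_eq_card_div]
  have hallpos : (0 : ℝ) < (heightFamilyBelow X).card := by
    have : 0 < c₁ * (X : ℝ) ^ (5 / 6 : ℝ) := mul_pos hc₁ hX56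
    have hle : (((heightFamilyBelow X).filter (IsGTFamily true)).card : ℝ) ≤ (heightFamilyBelow X).card := by
      exact_mod_cast Finset.card_le_card (Finset.filter_subset _ _)
    linarith
  rw [div_le_div_iff₀ hK0 hallpos]
  calc c₁ * ((heightFamilyBelow X).card : ℝ) ≤ c₁ * (K * (X : ℝ) ^ (5 / 6 : ℝ)) :=
        mul_le_mul_of_nonneg_left hX2 hc₁.le
    _ = K * (c₁ * (X : ℝ) ^ (5 / 6 : ℝ)) := by ring
    _ ≤ _ := by
        rw [mul_comm]
        exact mul_le_mul_of_nonneg_right hfilt hK0.le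

/-- The union of the two pieces has positive proportion. [folklore] -/
theorem exists_pos_le_heightProportion_unionMem_gtFamilies :
    ∃ c : ℝ, 0 < c ∧ ∀ᶠ X : ℕ in atTop, c ≤ heightProportion (UnionMem gtFamilies) X := by
  obtain ⟨c, hc, hev⟩ := exists_pos_le_heightProportion_isGTFamily
  refine ⟨c, hc, hev.mono fun X hX ↦ hX.trans (heightProportion_mono (fun AB h ↦ ?_) X)⟩
  exact (unionMem_gtFamilies_iff AB).mpr (Or.inl h)

end Density

end Literature.NumberTheory.EllipticCurves

end
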